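import Summits.QuantumFields.YangMills.Theorems.LuscherReductionTwistedTraceScalingBOSlowSchur
import Summits.QuantumFields.YangMills.Theorems.LuscherReductionTwistedTraceScalingBOKernel
import HarnessLib

/-!
# (C5) toolkit: the WEIGHTED Schur / Cauchy–Schwarz bound for kernel transfers — `∫ g·(∫ k(·,y)f(y)dy)² ≤ R·(sup_y ∫ k(x,y)g(x)dx)·∫ f²`
# (lane A of S-BASE, crux `TwistedTraceScaling` stmt-QuantumFields-20203, C4-CORE, the (OD) pen; `pub/ym-fleet/ym-luscher-20007-p1/COARSE-DESIGN.md` §27.3 (b)–(d), §30.5 (3))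

Every tail region of the (B-OD) defect (the Faddeev–Popov tail weight, the profile shell, the far stiff region, the gauge-far region) is an `L²` integral of a kernel transfer
`Kf(x) = ∫ k(x,y)f(y) dy` against a SMALL weight `g` (`g = 𝟙_region·χ/N`, or `g = 1/w` with a small kernel).  The bound that turns "pointwise small where it matters" into
"small in `L²` relative to `∫ f²`" is the weighted Schur test:
* ★★ `sq_integral_kernel_weight_le` — for a bounded measurable kernel `k ≥ 0` on finite measure spaces with row sums `∫ k(x,·) ≤ R`, a bounded measurable weight `g ≥ 0`
  with WEIGHTED column sums `∫ k(x,y)g(x) dx ≤ G` for all `y`, and bounded measurable `f`:  `∫ g(x)·(∫ k(x,y)f(y)dy)² dx ≤ R·G·∫ f²`.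
  (Cauchy–Schwarz in `y` with the measure `k(x,·)`, then Fubini.)  `G` carries the smallness (`e^{-cℓ²}`·poly) in every (C5) region, `R = sup row sum` of the transfer kernel.
HONEST FRAMING: a measure-theoretic tool for a stub of a child of the CONDITIONAL route R2b1; (C5), the final `b`, (B-ST), C4-CORE OPEN; not a gap, not Clay.
-/

set_option autoImplicit false

noncomputable section

open MeasureTheory Filter Topology Real
open scoped BigOperators
open Literature.MathematicalPhysics.QuantumFieldTheory
open Literature.MathematicalPhysics.QuantumLattice

namespace Summit.QuantumFields.YangMills.Theorems.FemtoTransferGap.TwoLattice.ConstTube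

open Summit.QuantumFields.YangMills.Theorems.FemtoTransferGap
open Summit.QuantumFields.YangMills.Theorems.FemtoTransferGap.TwoLattice
open Summit.QuantumFields.YangMills.Theorems.FemtoTransferGap.TwoLattice.Avg

/-! ## §1 ★★ The weighted Schur test -/

section Schur

variable {X : Type*} [MeasurableSpace X] (μ : Measure X) [IsFiniteMeasure μ]

/-- ★★ **WEIGHTED SCHUR TEST.**  `k ≥ 0` bounded jointly measurable with row sums `∫ k(x,y) dμ(y) ≤ R` (`R ≥ 0`), weight `g ≥ 0` bounded measurable with weighted column sums
`∫ k(x,y)g(x) dμ(x) ≤ G` for every `y`, `f` bounded measurable:  `∫ g(x)(∫ k(x,y)f(y)dμ)² dμ ≤ R·G·∫ f² dμ`. [cite: Helffer2013, Lemma 7.1] -/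
theorem sq_integral_kernel_weight_le {k : X → X → ℝ} (hk : Measurable (Function.uncurry k)) {Ck : ℝ} (hCk : ∀ x y, |k x y| ≤ Ck) (hk0 : ∀ x y, 0 ≤ k x y)
    {g : X → ℝ} (hg : Measurable g) {Cg : ℝ} (hCg : ∀ x, |g x| ≤ Cg) (hg0 : ∀ x, 0 ≤ g x)
    {f : X → ℝ} (hf : Measurable f) {Cf : ℝ} (hCf : ∀ y, |f y| ≤ Cf) {R G : ℝ} (hR : 0 ≤ R) (hrow : ∀ x, ∫ y, k x y ∂μ ≤ R)
    (hcol : ∀ y, ∫ x, k x y * g x ∂μ ≤ G) :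
    ∫ x, g x * (∫ y, k x y * f y ∂μ) ^ 2 ∂μ ≤ R * G * ∫ y, f y ^ 2 ∂μ := by
  have hCf0 : ∀ y : X, 0 ≤ Cf := fun y => (abs_nonneg _).trans (hCf y)
  have hCk0 : ∀ x : X, 0 ≤ Ck := fun x => (abs_nonneg _).trans (hCk x x)
  have hCg0 : ∀ x : X, 0 ≤ Cg := fun x => (abs_nonneg _).trans (hCg x)
  have hkx : ∀ x, Measurable (k x) := fun x => hk.comp (measurable_const.prodMk measurable_id)
  -- fibrewise Cauchy–Schwarz with weight `k(x,·)` and the row sum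
  have hpt : ∀ x, (∫ y, k x y * f y ∂μ) ^ 2 ≤ R * ∫ y, f y ^ 2 * k x y ∂μ := by
    intro x
    have hcs := sq_integral_mul_mul_le μ (a := fun _ => (1 : ℝ)) (b := f) (w := k x) measurable_const hf (hkx x) (Ca := 1) (fun _ => by rw [abs_one]) hCf (hCk x)
      (fun y => hk0 x y)
    have e1 : ∫ y, (1 : ℝ) * f y * k x y ∂μ = ∫ y, k x y * f y ∂μ := integral_congr_ae (ae_of_all _ fun y => by ring)
    have e2 : ∫ y, (1 : ℝ) ^ 2 * k x y ∂μ = ∫ y, k x y ∂μ := integral_congr_ae (ae_of_all _ fun y => by ring)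
    rw [e1, e2] at hcs
    have hI0 : 0 ≤ ∫ y, f y ^ 2 * k x y ∂μ := integral_nonneg fun y => mul_nonneg (sq_nonneg _) (hk0 x y)
    exact hcs.trans (mul_le_mul_of_nonneg_right (hrow x) hI0)
  -- the weighted version of the fibrewise bound
  have hptg : ∀ x, g x * (∫ y, k x y * f y ∂μ) ^ 2 ≤ R * ∫ y, g x * f y ^ 2 * k x y ∂μ := by
    intro x
    have h := mul_le_mul_of_nonneg_left (hpt x) (hg0 x)
    calc g x * (∫ y, k x y * f y ∂μ) ^ 2 ≤ g x * (R * ∫ y, f y ^ 2 * k x y ∂μ) := h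
      _ = R * ∫ y, g x * f y ^ 2 * k x y ∂μ := by rw [← integral_const_mul]; rw [← integral_const_mul, ← integral_const_mul]; exact integral_congr_ae (ae_of_all _ fun y => by ring)
  -- integrability facts
  have hJm : Measurable (Function.uncurry fun x y => g x * f y ^ 2 * k x y) := (((hg.comp measurable_fst).mul ((hf.pow_const 2).comp measurable_snd)).mul hk)
  have hJb : ∀ p : X × X, |(Function.uncurry fun x y => g x * f y ^ 2 * k x y) p| ≤ Cg * Cf ^ 2 * Ck := fun p => by
    simp only [Function.uncurry]
    rw [abs_mul, abs_mul, abs_pow]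
    exact mul_le_mul (mul_le_mul (hCg _) (pow_le_pow_left₀ (abs_nonneg _) (hCf _) 2) (by positivity) (hCg0 p.1)) (hCk _ _) (abs_nonneg _)
      (mul_nonneg (hCg0 p.1) (pow_nonneg (hCf0 p.2) 2))
  have hJint : Integrable (Function.uncurry fun x y => g x * f y ^ 2 * k x y) (μ.prod μ) := integrable_of_measurable_abs_le _ hJm hJb
  have hIm : Measurable fun x => ∫ y, k x y * f y ∂μ := by
    have hm : Measurable (Function.uncurry fun x y => k x y * f y) := hk.mul (hf.comp measurable_snd)
    exact (hm.stronglyMeasurable.integral_prod_right' (ν := μ)).measurable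
  have hIb : ∀ x, |∫ y, k x y * f y ∂μ| ≤ Ck * Cf * μ.real Set.univ := fun x => by
    calc |∫ y, k x y * f y ∂μ| ≤ ∫ y, |k x y * f y| ∂μ := abs_integral_le_integral_abs
      _ ≤ ∫ _y, Ck * Cf ∂μ := integral_mono_of_nonneg (ae_of_all _ fun _ => abs_nonneg _) (integrable_const _) (ae_of_all _ fun y => by
          show |k x y * f y| ≤ Ck * Cf
          rw [abs_mul]; exact mul_le_mul (hCk x y) (hCf y) (abs_nonneg _) (hCk0 x))
      _ = Ck * Cf * μ.real Set.univ := by rw [integral_const, smul_eq_mul, Measure.real]; ring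
  have hL : Integrable (fun x => g x * (∫ y, k x y * f y ∂μ) ^ 2) μ :=
    integrable_of_measurable_abs_le _ (hg.mul (hIm.pow_const 2)) (C := Cg * (Ck * Cf * μ.real Set.univ) ^ 2) fun x => by
      rw [abs_mul, abs_pow]; exact mul_le_mul (hCg x) (pow_le_pow_left₀ (abs_nonneg _) (hIb x) 2) (by positivity) (hCg0 x)
  have hinner_m : Measurable fun x => ∫ y, g x * f y ^ 2 * k x y ∂μ := (hJm.stronglyMeasurable.integral_prod_right' (ν := μ)).measurable
  have hinner_b : ∀ x, |∫ y, g x * f y ^ 2 * k x y ∂μ| ≤ Cg * Cf ^ 2 * Ck * μ.real Set.univ := fun x => by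
    calc |∫ y, g x * f y ^ 2 * k x y ∂μ| ≤ ∫ y, |g x * f y ^ 2 * k x y| ∂μ := abs_integral_le_integral_abs
      _ ≤ ∫ _y, Cg * Cf ^ 2 * Ck ∂μ := integral_mono_of_nonneg (ae_of_all _ fun _ => abs_nonneg _) (integrable_const _) (ae_of_all _ fun y => hJb (x, y))
      _ = Cg * Cf ^ 2 * Ck * μ.real Set.univ := by rw [integral_const, smul_eq_mul, Measure.real]; ring
  have hinner_int : Integrable (fun x => ∫ y, g x * f y ^ 2 * k x y ∂μ) μ := integrable_of_measurable_abs_le _ hinner_m hinner_b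
  -- integrate the fibrewise bound and swap
  have hcm : Measurable fun y => ∫ x, k x y * g x ∂μ := by
    have hm : Measurable (Function.uncurry fun x y => k x y * g x) := hk.mul (hg.comp measurable_fst)
    exact (hm.stronglyMeasurable.integral_prod_left' (μ := μ)).measurable
  have hcb : ∀ y, |∫ x, k x y * g x ∂μ| ≤ Ck * Cg * μ.real Set.univ := fun y => by
    calc |∫ x, k x y * g x ∂μ| ≤ ∫ x, |k x y * g x| ∂μ := abs_integral_le_integral_abs
      _ ≤ ∫ _x, Ck * Cg ∂μ := integral_mono_of_nonneg (ae_of_all _ fun _ => abs_nonneg _) (integrable_const _) (ae_of_all _ fun x => by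
          show |k x y * g x| ≤ Ck * Cg
          rw [abs_mul]; exact mul_le_mul (hCk x y) (hCg x) (abs_nonneg _) (hCk0 x))
      _ = Ck * Cg * μ.real Set.univ := by rw [integral_const, smul_eq_mul, Measure.real]; ring
  calc ∫ x, g x * (∫ y, k x y * f y ∂μ) ^ 2 ∂μ ≤ ∫ x, R * ∫ y, g x * f y ^ 2 * k x y ∂μ ∂μ := integral_mono hL (hinner_int.const_mul R) hptg
    _ = R * ∫ y, ∫ x, g x * f y ^ 2 * k x y ∂μ ∂μ := by rw [integral_const_mul, integral_integral_swap hJint]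
    _ = R * ∫ y, f y ^ 2 * ∫ x, k x y * g x ∂μ ∂μ := by
        congr 1; refine integral_congr_ae (ae_of_all _ fun y => ?_); dsimp only
        rw [← integral_const_mul]; exact integral_congr_ae (ae_of_all _ fun x => by ring)
    _ ≤ R * ∫ y, f y ^ 2 * G ∂μ := by
        refine mul_le_mul_of_nonneg_left ?_ hR
        refine integral_mono (integrable_of_measurable_abs_le _ ((hf.pow_const 2).mul hcm) (C := Cf ^ 2 * (Ck * Cg * μ.real Set.univ)) fun y => ?_)
          (integrable_of_measurable_abs_le _ ((hf.pow_const 2).mul measurable_const) (C := Cf ^ 2 * |G|) fun y => ?_) fun y => ?_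
        · rw [abs_mul, abs_pow]; exact mul_le_mul (pow_le_pow_left₀ (abs_nonneg _) (hCf _) 2) (hcb y) (abs_nonneg _) (pow_nonneg (hCf0 y) 2)
        · rw [abs_mul, abs_pow]; exact mul_le_mul (pow_le_pow_left₀ (abs_nonneg _) (hCf _) 2) le_rfl (abs_nonneg _) (pow_nonneg (hCf0 y) 2)
        · exact mul_le_mul_of_nonneg_left (hcol y) (sq_nonneg _)
    _ = R * G * ∫ y, f y ^ 2 ∂μ := by rw [integral_mul_const]; ring

end Schur

end Summit.QuantumFields.YangMills.Theorems.FemtoTransferGap.TwoLattice.ConstTube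

end
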